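import Literature.Probability.RandomPlanarGeometry.ChordalCurveFamily
import Literature.Probability.RandomPlanarGeometry.SLE
import HarnessLib

/-!
# Conformal restriction: the chordal case (Lawler–Schramm–Werner 2003)

Topic `Literature/Probability/RandomPlanarGeometry`. One NAMED FACT filed by a grounder for route
`CriticalPhenomena/SAWScalingLimit/SAWConfRestriction` (item `stmt-CriticalPhenomena-0775`,
decl `SAWConfRestriction.LSWRestrictionFact`).

## Source

G. F. Lawler, O. Schramm, W. Werner, *Conformal restriction: the chordal case*,
J. Amer. Math. Soc. **16** (2003) 917–955, arXiv:math/0209343 (arXiv page numbers below).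

* p. 5, main results 1–2: "1. The restriction measure `P_α` exists if and only if `α ≥ 5/8`.
  2. The only measure `P_α` that is supported on simple curves is `P_{5/8}`. It is the law of
  chordal SLE_{8/3}."
* Prop. 3.3 / Def. 3.4 (pp. 10–11): for a probability measure `P` on the space `Ω` of closed
  connected `K ⊆ ℍ̄` with `K ∩ ℝ = {0}`, `K` unbounded, `ℂ ∖ K` connected, the following are
  equivalent: (1) `P` is dilation-invariant and restriction-covariant; … (3) `∃ α > 0`,
  `P[K ∩ A = ∅] = Φ'_A(0)^α` for all hulls `A ∈ 𝒬*`; for each `α` there is at most one such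
  `P =: P_α` (the two-sided restriction measure with exponent `α`).
* Thm. 6.1 (p. 23): for the SLE_{8/3} path `γ` from `0` and `A ∈ 𝒬*`,
  `P[γ[0,∞) ∩ A = ∅] = Φ'_A(0)^{5/8}`; "The law of `γ(0,∞)` is therefore `P_{5/8}`."
* Thm. 7.3 (p. 29) (`P_α`, `α > 5/8`, is SLE_κ plus Brownian bubbles, hence not carried by simple
  curves) and Cor. 8.6 (p. 37) (`P_α` does not exist for `α < 5/8`).

## Transposition (design note — read before using the hypothesis)

The paper works in `(ℍ; 0, ∞)` with laws on closed sets `K` and the hulls `A ∈ 𝒬*` (compact,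
bounded away from `0`, `ℍ ∖ A` simply connected); "restriction" is: the law of `K` conditioned on
`K ∩ A = ∅` is the image of `P` under the conformal map `ℍ → ℍ ∖ A` fixing `0` and `∞`. The tree's
vocabulary is a `ChordalFamily` `P : DobrushinDomain → Measure (CurveClass ℂ)` (bounded Jordan
domains with two marked boundary points, curves modulo reparametrisation). The fact below is result
2 of p. 5 TRANSPOSED to that vocabulary, with the four hypotheses written exactly as the route
inlines them (definition items `defn-ChordalFamily.IsConformallyCovariant`,
`defn-ChordalFamily.IsRestriction` are pending; once they land the hypotheses are those defs
unfolded):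

* conformal covariance under every conformal `g : D → D'` with boundary values `a ↦ a'`,
  `b ↦ b'` (this both transports the law between domains, as LSW do by fiat, and imposes the
  dilation-invariance of Prop. 3.3 (1));
* two-sided restriction for Jordan sub-domains `D' ⊆ D` with the same marked points:
  `P D' (T) · P D (range ⊆ D̄') = P D (T ∩ {range ⊆ D̄'})` — the images of `ℍ ∖ A`, `A` a smooth
  hull, are such sub-domains (Carathéodory), which is all Prop. 3.3 (4) needs; the tree's family
  quantifies over more sub-domains (pinching at `a` or `b` allowed), a STRONGER hypothesis;
* carried by simple curves meeting `∂D` only at `a`, `b` (LSW: `K` a simple curve, `K ∩ ℝ = {0}`);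
* conclusion: `P D` is the chordal SLE_{8/3} law of the tree (`Literature.IsSLELaw (8/3) D`, `SLE.lean`).

The transposition (uniformizing map, boundary behaviour, `K ∩ A = ∅` versus `range ⊆ closure D'`,
which differ by a `P D`-null touching event under the simplicity hypothesis) is part of what a
user of `(h : LawlerSchrammWerner2003)` assumes; it is bookkeeping, not a further theorem of the
paper. Users take `(h : Literature.LawlerSchrammWerner2003)`.
-/

noncomputable section

open MeasureTheory
open scoped NNReal

namespace Literature.Probability.RandomPlanarGeometry

/-- NAMED FACT — **Lawler–Schramm–Werner 2003, p. 5 result 2** ("The only measure `P_α` that is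
supported on simple curves is `P_{5/8}`. It is the law of chordal SLE_{8/3}."; assembled in the
paper from Prop. 3.3/Def. 3.4, Thm. 6.1, Thm. 7.3 and Cor. 8.6), transposed to chordal curve
families on Dobrushin domains (see the module docstring): a chordal family which is conformally
covariant, has the two-sided restriction property and is carried by simple curves meeting the
boundary only at the marked points is, in every Dobrushin domain, the chordal SLE_{8/3} law.
Grounds `Summit.CriticalPhenomena.SAWScalingLimit.Theses.SAWConfRestriction.LSWRestrictionFact`
(which is this fact behind the two extra hypotheses `exists_isSLECurve`, `IsSLECurve.map_eq`).
[cite: LawlerSchrammWerner2003Restriction, p. 5 result 2; Prop. 3.3, Thm. 6.1, Cor. 8.6] -/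
def LawlerSchrammWerner2003 : Prop :=
  ∀ P : ChordalFamily, P.IsChordal →
    (∀ (D D' : DobrushinDomain) (g : ConformalEquiv D.carrier D'.carrier) (Φ : C(ℂ, ℂ)),
      g.HasBoundaryValue (D.pt 0) (D'.pt 0) → g.HasBoundaryValue (D.pt 1) (D'.pt 1) →
      Set.EqOn Φ g D.carrier → P D' = (P D).map (CurveClass.map Φ)) →
    (∀ (D D' : DobrushinDomain), D'.carrier ⊆ D.carrier → D'.pt 0 = D.pt 0 → D'.pt 1 = D.pt 1 →
      ∀ T : Set (CurveClass ℂ), MeasurableSet T →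
        P D' T * P D (CurveClass.rangeSubset (closure D'.carrier)) =
          P D (T ∩ CurveClass.rangeSubset (closure D'.carrier))) →
    (∀ D : DobrushinDomain, ∀ᵐ γ ∂(P D),
      γ ∈ CurveClass.simple ∧ γ.range ∩ frontier D.carrier ⊆ {D.pt 0, D.pt 1}) →
    ∀ D : DobrushinDomain, IsSLELaw ((8 : ℝ≥0) / 3) D (P D)

end Literature.Probability.RandomPlanarGeometry

end
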